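import Mathlib
import Summits.CriticalPhenomena.CardyFormulaZ2.Theorems.CardyMagicRigidityNestingRigiditySoftMachineSeqLimit
import Summits.CriticalPhenomena.CardyFormulaZ2.Theorems.CardyMagicRigidityNestingRigiditySoftMachineHitting
import Summits.CriticalPhenomena.CardyFormulaZ2.Theorems.CardyMagicRigidityNestingRigiditySoftMachineProduct
import Summits.CriticalPhenomena.CardyFormulaZ2.Theorems.CardyMagicRigidityNestingRigiditySoftMachineCloseness
import HarnessLib

/-!
# Soft machine, brick 6: the generic theorem — tight typed windowed collections ⇒ a measurable sequential
# `d_CN`-subsequential limit presented on `([0,1], Leb)`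

Crux `Summit.CriticalPhenomena.CardyFormulaZ2.Theses.CardyMagicRigidity.NestingRigidity`
(stmt-CriticalPhenomena-4835), line `positive-cone-weight-doubling`, registered stub `stub_tamePrecompactness`.
THE SOFT MACHINE (`softMachine_limit`, registered anchor), generic over the lattice: given, on a standard Borel
probability space `(Ω, P)`, a sequence `Xs k : Ω → C` of random typed loop configurations (the whole-plane loop
ensembles along a sequence of meshes) and closed loop collections `Ws k m i : Ω → LoopSpace ℂ` (the loops of type
`i` in the window `m`) such that

* (values) every `Ws k m i ω` is a compact set of loops; `Ws k m i` is measurable with finitely many values;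
* (tightness) for each `(m, i)` the laws of `Ws k m i`, `k ∈ ℕ`, are uniformly tight on the Aizenman–Burchard space;
* (faithfulness) inside `B(0, m + 2)` the members of `Ws k m i ω` are exactly the loops of `Xs k ω` of type `i`,

there are a subsequence `φ` and a presentation `X : [0,1] → C` such that `d_CN((P, Xs (φ k)), (Leb, X)) → 0`, and
`X` has MEASURABLE HITTING EVENTS `{s | some loop of type i of X s lies in Q}`, `Q` closed — the intrinsic property
from which the measurability of all closeness events against countably generated lattice ensembles follows
(brick 7).  Assembly: product element and compact family (brick 4) ⇒ sequential Prokhorov extraction,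
presentation `f : [0,1] → 𝕐` and couplings (brick 1) ⇒ `X s = Φ (f s)` on `f s ∈ ⋃ Kₙ` (the
overlapping-responsibility rule of brick 5), empty otherwise ⇒ hitting events are countable unions of the Borel
events of brick 2 ⇒ for `ε > 0`, the coupling realised on `Ω × [0,1]` (brick 1) has exceptional event inside
"`edist ≥ θ` or `f s ∉ ⋃ Kₙ`", of probability `≤ 3θ < ε`, because off it brick 5 applies.
-/

noncomputable section

open MeasureTheory Set Filter Metric TopologicalSpace Function Encodable
open scoped Topology ENNReal NNReal PiCountable unitInterval

namespace Summit.CriticalPhenomena.CardyFormulaZ2.Cruxes.NestingRigidity.PositiveConeWeightDoubling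

open Literature.Probability.RandomPlanarGeometry

namespace SoftMachine

/-- A measure smaller than `((n : ℝ≥0∞) + 1)⁻¹` on the complements of an exhausting family vanishes on the complement
of the union. -/
theorem measure_compl_iUnion_eq_zero {S : Type*} [MeasurableSpace S] (ν : Measure S) {K : ℕ → Set S}
    (h : ∀ n, ν (K n)ᶜ ≤ ((n : ℝ≥0∞) + 1)⁻¹) : ν (⋃ n, K n)ᶜ = 0 := by
  refine le_antisymm (ENNReal.le_of_forall_pos_le_add fun ε hε _ ↦ ?_) bot_le
  rw [zero_add]
  obtain ⟨n, hn⟩ := exists_nat_gt (ε : ℝ)⁻¹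
  have hε' : (0 : ℝ) < ε := by exact_mod_cast hε
  calc ν (⋃ n, K n)ᶜ ≤ ν (K n)ᶜ := measure_mono (compl_subset_compl.2 (subset_iUnion K n))
    _ ≤ ((n : ℝ≥0∞) + 1)⁻¹ := h n
    _ ≤ ε := by
        rw [← ENNReal.ofReal_coe_nnreal, show ((n : ℝ≥0∞) + 1) = ENNReal.ofReal ((n : ℝ) + 1) by
          rw [ENNReal.ofReal_add (Nat.cast_nonneg n) zero_le_one, ENNReal.ofReal_natCast, ENNReal.ofReal_one],
          ← ENNReal.ofReal_inv_of_pos (by positivity)]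
        refine ENNReal.ofReal_le_ofReal ?_
        rw [inv_le_comm₀ (by positivity) hε']
        linarith

/-- The mass bounds `((n : ℝ≥0∞) + 1)⁻¹` as an `ℝ≥0`-sequence tending to `0`. -/
theorem tendsto_inv_nat_succ : Tendsto (fun n : ℕ ↦ ((n : ℝ≥0) + 1)⁻¹) atTop (𝓝 0) := by
  rw [← NNReal.tendsto_coe]
  simp only [NNReal.coe_inv, NNReal.coe_add, NNReal.coe_natCast, NNReal.coe_one, NNReal.coe_zero]
  simpa only [one_div] using tendsto_one_div_add_atTop_nhds_zero_nat (𝕜 := ℝ)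

/-- Coercion of the mass bounds. -/
theorem coe_inv_nat_succ (n : ℕ) : ((((n : ℝ≥0) + 1)⁻¹ : ℝ≥0) : ℝ≥0∞) = ((n : ℝ≥0∞) + 1)⁻¹ := by
  rw [ENNReal.coe_inv (by positivity)]
  push_cast
  rfl

end SoftMachine

open SoftMachine in
/-- **THE SOFT MACHINE** (registered anchor `softMachine_limit`); see the module docstring. -/
theorem softMachine_limit : ∀ (Ω : Type) [MeasurableSpace Ω] [StandardBorelSpace Ω] [Nonempty Ω]
    (P : Measure Ω) [IsProbabilityMeasure P] (Xs : ℕ → Ω → LoopConfig ℂ)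
    (Ws : ℕ → ℕ → Fin 2 → Ω → LoopSpace ℂ),
    (∀ k m i, Measurable (Ws k m i)) → (∀ k m i, (Set.range (Ws k m i)).Finite) →
    (∀ k m i ω, IsCompact (Ws k m i ω : Set (CurveClass ℂ)) ∧ ∀ c ∈ Ws k m i ω, CurveClass.IsLoop c) →
    (∀ (m : ℕ) (i : Fin 2) (ε : ℝ≥0∞), 0 < ε →
      ∃ K : Set (LoopSpace ℂ), IsCompact K ∧ ∀ k, P (Ws k m i ⁻¹' Kᶜ) ≤ ε) →
    (∀ k (m : ℕ) (i : Fin 2) ω (u : UnbasedLoop ℂ), u ∈ (Xs k ω).F i → u.range ⊆ ball (0 : ℂ) (m + 2) →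
      ∃ c ∈ Ws k m i ω, ∃ h : c.IsLoop, UnbasedLoop.mk (BasedLoop.mk c h) = u) →
    (∀ k (m : ℕ) (i : Fin 2) ω (c : CurveClass ℂ), c ∈ Ws k m i ω → c.range ⊆ ball (0 : ℂ) (m + 2) →
      ∃ h : c.IsLoop, UnbasedLoop.mk (BasedLoop.mk c h) ∈ (Xs k ω).F i) →
    ∃ φ : ℕ → ℕ, StrictMono φ ∧ ∃ X : unitInterval → LoopConfig ℂ,
      (∀ (i : Fin 2) (Q : Set (UnbasedLoop ℂ)), IsClosed Q → MeasurableSet {s | ∃ u ∈ (X s).F i, u ∈ Q}) ∧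
      Tendsto (fun k ↦ LoopConfig.cnLawEDist P (Xs (φ k)) volume X) atTop (𝓝 0) := by
  intro Ω _ _ _ P _ Xs Ws hmeas hfin hval htight hR1 hR2
  classical
  -- the product space, with its Borel σ-algebra
  letI : MeasurableSpace (ℕ × Fin 2 → LoopSpace ℂ) := borel _
  haveI : BorelSpace (ℕ × Fin 2 → LoopSpace ℂ) := ⟨rfl⟩
  -- the product elements
  set z : ℕ → Ω → (ℕ × Fin 2 → LoopSpace ℂ) :=
    fun k ω j ↦ if j.1 ≤ k then Ws k j.1 j.2 ω else (⊥ : LoopSpace ℂ) with hzdef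
  have hz : ∀ k, Measurable (z k) ∧ (Set.range (z k)).Finite := fun k ↦
    measurable_and_finite_range_prodElem Ws k (fun m i _ ↦ hmeas k m i) (fun m i _ ↦ hfin k m i)
  -- the compact family
  obtain ⟨K, hKc, hKcl, hKmono, hKsub, hKmass⟩ := softMachine_exists_compact_family Ω P Ws hval htight
  -- the laws
  set μ : ℕ → ProbabilityMeasure (ℕ × Fin 2 → LoopSpace ℂ) :=
    fun k ↦ ⟨P.map (z k), Measure.isProbabilityMeasure_map (hz k).1.aemeasurable⟩ with hμ
  have hmass : ∀ k n, (μ k : Measure (ℕ × Fin 2 → LoopSpace ℂ)) (K n)ᶜ ≤ ((n : ℝ≥0) + 1)⁻¹ := by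
    intro k n
    change (P.map (z k)) (K n)ᶜ ≤ _
    rw [Measure.map_apply (hz k).1 (hKcl n).measurableSet.compl, coe_inv_nat_succ]
    exact hKmass n k
  -- sequential extraction, presentation, couplings
  obtain ⟨φ, hφ, ν, hνmass, -, ⟨f, hf, -, hfν⟩, hcoup⟩ :=
    SoftMachine.exists_subseq_presentation μ tendsto_inv_nat_succ hKc hKmono hmass
  have hνS : (ν : Measure (ℕ × Fin 2 → LoopSpace ℂ)) (⋃ n, K n)ᶜ = 0 :=
    measure_compl_iUnion_eq_zero _ fun n ↦ by rw [← coe_inv_nat_succ]; exact hνmass n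
  have hSm : MeasurableSet (⋃ n, K n) := MeasurableSet.iUnion fun n ↦ (hKcl n).measurableSet
  -- the limit presentation
  set Φ : (ℕ × Fin 2 → LoopSpace ℂ) → LoopConfig ℂ := fun y ↦
    ⟨fun i ↦ {u | ∃ (m : ℕ), ∃ c ∈ (y (m, i) : Set (CurveClass ℂ)),
      c.range ⊆ closedBall (0 : ℂ) (m + 1) ∧ ¬ c.range ⊆ closedBall (0 : ℂ) (m - 3 / 4) ∧
        ∃ h : c.IsLoop, UnbasedLoop.mk (BasedLoop.mk c h) = u}⟩ with hΦ
  set X : unitInterval → LoopConfig ℂ := fun s ↦ if f s ∈ ⋃ n, K n then Φ (f s) else ⟨fun _ ↦ ∅⟩ with hX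
  refine ⟨φ, hφ, X, fun i Q hQ ↦ ?_, ?_⟩
  · -- measurability of the hitting events
    have hset : {s | ∃ u ∈ (X s).F i, u ∈ Q} = ⋃ n, ⋃ m : ℕ, f ⁻¹' (K n ∩ {y | ∃ c ∈ (y (m, i) : Set (CurveClass ℂ)),
        c ∈ {c : CurveClass ℂ | c.range ⊆ closedBall (0 : ℂ) (m + 1)} ∧
        c ∈ {c : CurveClass ℂ | ¬ c.range ⊆ closedBall (0 : ℂ) (m - 3 / 4)} ∧
        ∃ h : c.IsLoop, UnbasedLoop.mk (BasedLoop.mk c h) ∈ Q}) := by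
      ext s
      simp only [mem_setOf_eq, mem_iUnion, mem_preimage, mem_inter_iff]
      constructor
      · rintro ⟨u, hu, huQ⟩
        by_cases hs : f s ∈ ⋃ n, K n
        · have hXs : X s = Φ (f s) := if_pos hs
          rw [hXs] at hu
          obtain ⟨m, c, hc, hr1, hr2, h, rfl⟩ := hu
          obtain ⟨n, hn⟩ := mem_iUnion.1 hs
          exact ⟨n, m, hn, c, hc, hr1, hr2, h, huQ⟩
        · have hXs : X s = ⟨fun _ ↦ ∅⟩ := if_neg hs
          rw [hXs] at hu
          exact absurd hu (notMem_empty u)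
      · rintro ⟨n, m, hn, c, hc, hr1, hr2, h, hcQ⟩
        have hs : f s ∈ ⋃ n, K n := mem_iUnion.2 ⟨n, hn⟩
        have hXs : X s = Φ (f s) := if_pos hs
        rw [hXs]
        exact ⟨_, ⟨m, c, hc, hr1, hr2, h, rfl⟩, hcQ⟩
    rw [hset]
    refine MeasurableSet.iUnion fun n ↦ MeasurableSet.iUnion fun m ↦ ?_
    exact softMachine_measurableSet_preimage_inter_hit (ℕ × Fin 2) unitInterval f (K n) (m, i) Q
      {c : CurveClass ℂ | c.range ⊆ closedBall (0 : ℂ) (m + 1)}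
      {c : CurveClass ℂ | ¬ c.range ⊆ closedBall (0 : ℂ) (m - 3 / 4)} hf (hKcl n)
      (fun y hy j ↦ (hKsub n hy j).1) hQ (CurveClass.isClosed_rangeSubset isClosed_closedBall)
      (isOpen_setOf_not_range_subset isClosed_closedBall)
  · -- convergence in `d_CN`
    rw [ENNReal.tendsto_nhds_zero]
    intro ε' hε'
    -- a real `ε₀ ∈ (0, 1]` below `ε'`
    obtain ⟨ε₀, hε₀, hε₀1, hε₀'⟩ : ∃ ε₀ : ℝ, 0 < ε₀ ∧ ε₀ ≤ 1 ∧ ENNReal.ofReal ε₀ ≤ ε' := by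
      rcases eq_or_ne ε' ⊤ with h | h
      · exact ⟨1, one_pos, le_rfl, h ▸ le_top⟩
      · refine ⟨min ε'.toReal 1, lt_min (ENNReal.toReal_pos hε'.ne' h) one_pos, min_le_right _ _, ?_⟩
        exact (ENNReal.ofReal_le_ofReal (min_le_left _ _)).trans (ENNReal.ofReal_toReal_le)
    -- parameters
    set M : ℕ := ⌈1 / ε₀⌉₊ + 1 with hM
    set η₁ : ℝ := ε₀ / 4 with hη₁
    have hη₁0 : 0 < η₁ := by positivity
    set J : Finset (ℕ × Fin 2) := Finset.range (M + 1) ×ˢ Finset.univ with hJ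
    have hJne : J.Nonempty := ⟨(0, 0), by simp [hJ]⟩
    set θ : ℝ≥0∞ := min (ENNReal.ofReal η₁) (J.inf' hJne fun j ↦ 2⁻¹ ^ encode j) with hθ
    have hθpos : 0 < θ := by
      refine lt_min (ENNReal.ofReal_pos.2 hη₁0) ?_
      rw [Finset.lt_inf'_iff]
      exact fun j _ ↦ ENNReal.pow_pos (by norm_num) _
    have hθtop : θ ≠ ⊤ := ne_top_of_le_ne_top ENNReal.ofReal_ne_top (min_le_left _ _)
    have hθη : θ ≤ ENNReal.ofReal η₁ := min_le_left _ _
    have hθJ : ∀ j ∈ J, θ ≤ 2⁻¹ ^ encode j := fun j hj ↦ (min_le_right _ _).trans (Finset.inf'_le _ hj)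
    have hθreal : ENNReal.ofReal θ.toReal = θ := ENNReal.ofReal_toReal hθtop
    have h3 : 3 * θ < ENNReal.ofReal ε₀ := by
      calc 3 * θ ≤ 3 * ENNReal.ofReal η₁ := by gcongr
        _ = ENNReal.ofReal (3 * η₁) := by rw [ENNReal.ofReal_mul (by norm_num), ENNReal.ofReal_ofNat]
        _ < ENNReal.ofReal ε₀ := (ENNReal.ofReal_lt_ofReal_iff hε₀).2 (by rw [hη₁]; linarith)
    -- eventually: couplings at scale `θ`, and all windows `m ≤ M` genuine
    filter_upwards [hcoup θ.toReal (ENNReal.toReal_pos hθpos.ne' hθtop), eventually_ge_atTop M] with k hk hkM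
    obtain ⟨π, hπ, hπ1, hπ2, hπθ⟩ := hk
    rw [hθreal] at hπθ
    have hπ1' : π.map Prod.fst = P.map (z (φ k)) := by rw [hπ1]; rfl
    obtain ⟨R, hRfst, hRsnd, hRE⟩ :=
      SoftMachine.exists_coupling_base P (hz (φ k)).1 (hz (φ k)).2 hf hfν hπ1' hπ2
    refine hε₀'.trans' (LoopConfig.cnLawEDist_le_of_coupling hε₀ R hRfst hRsnd ?_)
    -- the exceptional event
    set E : Set ((ℕ × Fin 2 → LoopSpace ℂ) × (ℕ × Fin 2 → LoopSpace ℂ)) :=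
      {q | θ ≤ edist q.1 q.2} ∪ Prod.snd ⁻¹' (⋃ n, K n)ᶜ with hE
    have hπE : π E ≤ 3 * θ := by
      calc π E ≤ π {q | θ ≤ edist q.1 q.2} + π (Prod.snd ⁻¹' (⋃ n, K n)ᶜ) := measure_union_le _ _
        _ ≤ 3 * θ + 0 := by
            gcongr
            · rw [← Measure.map_apply measurable_snd hSm.compl, hπ2, hνS]
        _ = 3 * θ := add_zero _
    have hkφ : M ≤ φ k := hkM.trans (hφ.id_le k)
    refine lt_of_le_of_lt ((measure_mono ?_).trans ((hRE E).trans hπE)) h3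
    -- off the exceptional event, brick 5 applies
    rintro ⟨ω, s⟩ hp
    by_contra hgood
    apply hp
    simp only [mem_setOf_eq, hE, mem_union, mem_preimage, mem_compl_iff, not_or, not_not, not_le] at hgood
    obtain ⟨hdist, hsS⟩ := hgood
    have hXs : X s = Φ (f s) := if_pos hsS
    obtain ⟨n, hn⟩ := mem_iUnion.1 hsS
    change LoopConfig.IsClose ε₀ (Xs (φ k) ω) (X s)
    rw [hXs]
    refine softMachine_isClose_of_coords_close (Xs (φ k) ω) (fun m i ↦ Ws (φ k) m i ω) (f s) ε₀ η₁ hε₀ hη₁0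
      (by rw [hη₁]; linarith) (by rw [hη₁]; linarith) (fun j ↦ (hKsub n hn j).2)
      (fun m i u hu hur ↦ hR1 (φ k) m i ω u hu hur) (fun m i c hc hcr ↦ hR2 (φ k) m i ω c hc hcr) ?_
    intro m i hm
    have hj : (m, i) ∈ J := by
      simp only [hJ, Finset.mem_product, Finset.mem_range, Finset.mem_univ, and_true]
      omega
    have hcoord : edist (z (φ k) ω (m, i)) (f s (m, i)) ≤ edist (z (φ k) ω) (f s) :=
      PiCountable.edist_le_edist_pi_of_edist_lt (hdist.trans_le (hθJ _ hj))
    have hzm : z (φ k) ω (m, i) = Ws (φ k) m i ω := by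
      simp only [hzdef]
      rw [if_pos (show ((m, i) : ℕ × Fin 2).1 ≤ φ k from hm.trans hkφ)]
    rw [← hzm]
    exact hcoord.trans_lt (hdist.trans_le hθη)

end Summit.CriticalPhenomena.CardyFormulaZ2.Cruxes.NestingRigidity.PositiveConeWeightDoubling

end
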